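import Mathlib
import HarnessLib
import Summits.CriticalPhenomena.PercolationContinuityZ3.Theses.PercBudgetLadder
import Literature.Probability.Percolation.MinOpenCut
import Literature.Probability.Percolation.PercolationEvents

/-!
# Sketch — crux-ideate stmt-CriticalPhenomena-5248 (BudgetTightness), ideator 2, round 1

First-lemma signatures of the three idea cards (they need not be proved here; they must
elaborate).  Namespace per the crux protocol.
-/

noncomputable section

namespace Summit.CriticalPhenomena.PercolationContinuityZ3.Cruxes.BudgetTightness.SketchIdeator2

open MeasureTheory
open Literature.Probability.Percolation Literature.Probability.LatticeModels
open Summit.CriticalPhenomena.PercolationContinuityZ3.Theses.PercBudgetLadder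

/-- Critical bond percolation on `ℤ³`. -/
abbrev Pc : Measure (BondConfig (Site 3)) := bondPercolation (zdGraph 3) (criticalProbI 3)

/-- The annulus crossing event `{box m ↔ ∂ⁱⁿ box (l m) inside box (l m)}` (complement of the
`k = 0` budget event of the route). -/
def annulusCrossing (m l : ℕ) : Set (BondConfig (Site 3)) :=
  {ω | ∃ x ∈ box 3 m, ∃ y ∈ innerBoundary (zdGraph 3) (box 3 (l * m)),
      ω ∈ openConnIn (↑(box 3 (l * m)) : Set (Site 3)) x y}

/-- The critical min-cut budget of the annulus, `MinCut(m, l m)`, via the landed definitions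
module (`minOpenCutIn_le_iff` is verbatim the route's inlined form). -/
def annulusMinCut (m l : ℕ) (ω : BondConfig (Site 3)) : ℕ∞ :=
  minOpenCutIn (↑(box 3 (l * m)) : Set (Site 3)) (↑(box 3 m) : Set (Site 3))
    (↑(innerBoundary (zdGraph 3) (box 3 (l * m))) : Set (Site 3)) ω

/-- The annulus path-packing number (max number of edge-disjoint open crossings). -/
def annulusMaxFlow (m l : ℕ) (ω : BondConfig (Site 3)) : ℕ∞ :=
  maxDisjointOpenPathsIn (↑(box 3 (l * m)) : Set (Site 3)) (↑(box 3 m) : Set (Site 3))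
    (↑(innerBoundary (zdGraph 3) (box 3 (l * m))) : Set (Site 3)) ω

/-! ## Card A — `slab-flow-constant-transfer` -/

/-- The slab piece `[0,L]² × [0,h]` of `ℤ³`. -/
def piece (L h : ℕ) : Set (Site 3) :=
  {x | 0 ≤ x 0 ∧ x 0 ≤ L ∧ 0 ≤ x 1 ∧ x 1 ≤ L ∧ 0 ≤ x 2 ∧ x 2 ≤ h}

/-- Its bottom layer `z = 0`. -/
def pieceBottom (L h : ℕ) : Set (Site 3) := {x | x ∈ piece L h ∧ x 2 = 0}

/-- Its top layer `z = h`. -/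
def pieceTop (L h : ℕ) : Set (Site 3) := {x | x ∈ piece L h ∧ x 2 = h}

/-- Expected critical bottom-to-top min-cut of the piece (Kesten's minimal-weight surface with
`{0,1}` weights at the critical density). -/
def slabCutMean (L h : ℕ) : ℝ :=
  ∫ ω, ((minOpenCutIn (piece L h) (pieceBottom L h) (pieceTop L h) ω).toNat : ℝ) ∂Pc

/-- **Transfer `C⁺`** (`SlabCutQuadraticIO`): along a subsequence of thicknesses `h`, the
critical slab min-cut per unit area is `O(h⁻²)` uniformly in the lateral size — i.e.
`liminf_h h² τ_h(p_c) < ∞` for the slab flow constant `τ_h = sup_{L ≥ h} slabCutMean L h / L²`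
(lateral sizes `L ≥ h` only: this is all the six-lids lemma uses, and it is what the patch-cutset
lemma gives back from `BudgetTightness`, so the two are equivalent modulo Menger). -/
def SlabCutQuadraticIO : Prop :=
  ∃ C : ℝ, ∀ H : ℕ, ∃ h : ℕ, H ≤ h ∧ ∀ L : ℕ, h ≤ L → (h : ℝ) ^ 2 * slabCutMean L h ≤ C * (L : ℝ) ^ 2

/-- **First lemma of card A (six lids + Markov).** `C⁺ ⇒ BudgetTightness`: the annulus min-cut is
at most the sum of the six lid-piece min-cuts (union of cutsets; lid = lateral side `2·2n+1`,
thickness `n-1`, a translate/rotation of `piece (4n) (n-1)`), so with `h = n - 1` good,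
`E MinCut(n,2n) ≤ 6·C·(4n+1)²/(n-1)²`, and Markov gives budget `k = ⌈2·6·C·81⌉`, `l = 2`,
`c = 1/2` along `n = h + 1`. -/
theorem budgetTightness_of_slabCutQuadraticIO (h : SlabCutQuadraticIO) : BudgetTightness := by
  sorry

/-- Lateral superadditivity of the expected piece min-cut (restriction of a cutset of the big
piece to a laterally disjoint sub-piece is a cutset of the sub-piece; Menger-free), which makes
`L ↦ slabCutMean L h / L²` converge to its supremum `τ_h`. -/
theorem slabCutMean_superadditive (L h k : ℕ) (hk : 1 ≤ k) :
    (k : ℝ) ^ 2 * slabCutMean L h ≤ slabCutMean (k * (L + 1) - 1) h := by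
  sorry

/-- The universal lower bound `τ_h(p_c) ≥ c/h²` (from `P_{p_c}(box n ↔ ∂ box 2n) ≥ ε₀` and the
square-root trick): `C⁺` says the critical slab flow constant sits at this floor i.o. -/
theorem slabCutMean_lower : ∃ c : ℝ, 0 < c ∧ ∀ h : ℕ, 1 ≤ h →
    c * ((4 * (h + 1) : ℕ) : ℝ) ^ 2 ≤ (h : ℝ) ^ 2 * slabCutMean (4 * (h + 1)) h := by
  sorry

/-! ## Card B — `bk-first-moment-reduction` -/

/-- Bounded expected critical annulus min-cut along a subsequence. -/
def MeanCutBoundedIO : Prop :=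
  ∃ (l : ℕ) (C : ℝ), 2 ≤ l ∧ ∀ N : ℕ, ∃ n : ℕ, N ≤ n ∧
    ∫ ω, ((annulusMinCut n l ω).toNat : ℝ) ∂Pc ≤ C

/-- **First lemma of card B, easy half (Markov).** PROVED in the companion workfile
`FirstMomentMarkov-ideator2.lean` (as `budgetTightness_of_meanCutBoundedIO'`, rc 0, 0 sorry, standard
axioms); kept sorried here to leave this signature file import-light. -/
theorem budgetTightness_of_meanCutBoundedIO (h : MeanCutBoundedIO) : BudgetTightness := by
  sorry

/-- **First lemma of card B, BK half (Menger-free form).** Universally,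
`P(blocked) · E[path-packing number] ≤ 1`: by BK, `P(ν ≥ k) ≤ P(crossed)^k`, so
`E ν ≤ f/(1-f)`.  With Menger (`ν = MinCut`, a support item) this gives
`BudgetTightness ↔ MeanCutBoundedIO` and `P(blocked) ≤ 1/(m_n - 1)` (no atom at `0` over a
diverging bulk). -/
theorem blocked_mul_meanFlow_le_one (n l : ℕ) (hl : 2 ≤ l) (hn : 1 ≤ n) :
    Pc.real (annulusCrossing n l)ᶜ * ∫ ω, ((annulusMaxFlow n l ω).toNat : ℝ) ∂Pc ≤ 1 := by
  sorry

/-! ## Card C — `seeded-russo-pivotal-boost` -/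

/-- **First lemma of card C.** Seeded Duminil-Copin–Tassion inequality × BK seed-splitting:
`π(m) · E_{p_c}[N_piv(annulus crossing)] ≥ c · P_{p_c}(annulus blocked)` with
`π(m) = P_{p_c}(0 ↔ ∂ box m)`; i.e. the expected number of pivotal edges of the critical
annulus-crossing event is at least `c · P(blocked)/π(m)`.  (`c = 1/(p_c(1-p_c))·(1/p_c)` up to
the lattice constant.) -/
theorem pivotal_boost : ∃ c : ℝ, 0 < c ∧ ∀ m l : ℕ, 1 ≤ m → 2 ≤ l →
    c * Pc.real (annulusCrossing m l)ᶜ ≤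
      Pc.real (siteToBoundary 3 m) *
        ∫ ω, ((pivotals (annulusCrossing m l) ω ∩ (zdGraph 3).edgeSet).encard.toNat : ℝ) ∂Pc := by
  sorry

/-- Pivotal balance (Russo, exact): open-pivotal mass on `crossed` and closed-pivotal mass on
`blocked` are proportional, so `P(MinCut ≤ 1) = P(blocked) + P(crossed ∧ ∃ open pivotal)` and
`E[#closed pivotals | blocked] ≥ c(1-p_c)/π(m)`. Stated: `P(MinCut ≤ 1) ≥ P(∃ pivotal edge)`. -/
theorem minCut_le_one_of_pivotal (m l : ℕ) (ω : BondConfig (Site 3))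
    (h : (pivotals (annulusCrossing m l) ω ∩ (zdGraph 3).edgeSet).Nonempty) :
    annulusMinCut m l ω ≤ 1 := by
  sorry

end Summit.CriticalPhenomena.PercolationContinuityZ3.Cruxes.BudgetTightness.SketchIdeator2

end
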